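import Literature.MathematicalPhysics.QuantumFieldTheory.Balaban1983to89.B3DivergentGraphs

/-!
# `Balaban1983to89.B3LineCut` — T. Bałaban, *(Higgs)₂,₃ quantum fields in a finite volume. III. Renormalization*,
Commun. Math. Phys. **88** (1983) 411–445 [Balaban1983Higgs3]: p. 432, replacing internal lines by pairs of external fields does
not lower the degree, DECIDED on the concrete family of graphs `B3Cor23Concrete.Graph`

statement-level skeleton of published theorems with citation tags; proofs where landed; nothing here is a claim about the Yang–Mills mass gap

PDF held: `paper:balaban1983-higgs-2-3-quantum-fields-finite-volume` (journal page = PDF page + 410); renders read as images: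
`…/b2b-balaban-ref1/pages/1983-cmp88-higgs23-III/1983-cmp88-higgs23-III-p012, p016, p022-x2.png` (pp. 422, 426, 432).
CITATION HEADER (lean-in-tree rule).  lit-balaban TYPED SKELETON (HOME `run/shared/lean/pub/lit-balaban/`), Phase 2, seat p18
(gen 2), unit `lit-balaban-p18`: the reduction paragraph of Sect. 3 between (3.1) and (3.2), p. 432 [PDF 22] (SKELETON rows
B3.Eq3.1 / B3.Eq3.2, owner r15), verbatim: *"Thus we remove from every G ∈ G_ren all the lines corresponding to the operators of
the types described above, more exactly we replace these lines by pairs of external legs. … Generally, if we replace a line in an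
arbitrary graph G by a pair of external fields, then the degree of the new graph is greater or equal to the degree of G, thus a
convergent graph is transformed into a convergent one."*  Model: `B3Cor23Concrete` (seat p18 gen 1), degree (2.1)/(2.2).

WHAT THIS MODULE PROVES (sorry-free; two `def`s with bodies — the graph with some lines replaced by external legs, and a
two-vertex witness; no `Prop` fact introduced).  `restrict`: the graph obtained from G by keeping the internal lines through a
set of legs closed under «the other endpoint» and replacing all other lines by pairs of external legs (one line: `keep x :=
x ≠ a ∧ x ≠ b`).  (1) `deg_le_deg_restrict`: for a graph WITHOUT vertices of the form (1.14)–(1.15) the printed sentence holds in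
every dimension d ≥ 2 — each leg made external raises (2.1) by (d−2)/2 ≥ 0, each differentiation taken off a line by 1.
(2) `deg_restrict_pos`: in d = 3 the printed consequence *"a convergent graph is transformed into a convergent one"* holds for
EVERY graph of the model (graphs with a vertex (1.13)–(1.15) have D > 0 before and after, Cor. 2.3 first clause, seat p18 gen 1).
(3) `deg_restrict_lt_of_averaging`: the inequality «degree of the new graph ≥ degree of G» itself FAILS on the model for a line
joining A′-legs of two vertices of the form (1.14): by (2.1) such a leg counts −(d−2)/2 + 1 when internal (the *"additional
factor L^jη"* of p. 426) and 0 when external, so the cut LOWERS the degree by 1 in d = 3 (witness `avgPair`); recorded in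
HOME/GAPS.md, consequence (2) unaffected.
-/

namespace Literature.MathematicalPhysics.QuantumFieldTheory.Balaban1983to89.B3LineCut

open Finset B3Prop1 B3Sect2Statements B3VertexBridge B3Cor23Concrete B3DivergentGraphs

variable {nbar : ℕ} (G : Graph nbar)

/-! ## Replacing lines by pairs of external legs -/

/-- p. 432 [PDF 22]: *"we replace these lines by pairs of external legs"* — the graph obtained from G by keeping exactly the internal
lines through the legs satisfying `keep` (a set of legs closed under «the other endpoint») and making every other leg external;
same vertices. At least one line must be kept (p. 415: a graph has at least one internal line). [cite: Balaban1983Higgs3, p.432] -/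
def restrict (keep : Leg G.kind → Prop) [DecidablePred keep] (hkeep : ∀ x y, G.other x = some y → keep x → keep y)
    (hex : ∃ x, keep x ∧ (G.other x).isSome) : Graph nbar where
  nV := G.nV
  kind := G.kind
  adm := G.adm
  other x := if keep x then G.other x else none
  other_ne x y h := by
    by_cases hx : keep x
    · simp only [hx, if_true] at h; exact G.other_ne x y h
    · simp [hx] at h
  other_symm x y h := by
    by_cases hx : keep x
    · simp only [hx, if_true] at h
      simp only [hkeep x y h hx, if_true]
      exact G.other_symm x y h
    · simp [hx] at h
  other_isLeft x y h := by
    by_cases hx : keep x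
    · simp only [hx, if_true] at h; exact G.other_isLeft x y h
    · simp [hx] at h
  exists_line := by
    obtain ⟨x, hx, hs⟩ := hex
    exact ⟨x, by simp only [hx, if_true]; exact hs⟩

section restrict

variable (keep : Leg G.kind → Prop) [DecidablePred keep] (hkeep : ∀ x y, G.other x = some y → keep x → keep y)
  (hex : ∃ x, keep x ∧ (G.other x).isSome)

/-- kernel: a leg internal in the new graph is internal in G. [cite: Balaban1983Higgs3, p.432] -/
theorem isSome_of_restrict (x : Leg G.kind) (h : ((restrict G keep hkeep hex).other x).isSome) : (G.other x).isSome := by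
  have h' : (if keep x then G.other x else none).isSome = true := h
  by_cases hx : keep x
  · simpa [hx] using h'
  · simp [hx] at h'

/-- kernel: the new graph has at most as many internal φ′-legs at each vertex. [cite: Balaban1983Higgs3, (2.1) p.422] -/
theorem intScalar_restrict_le (i : Fin G.nV) : (restrict G keep hkeep hex).intScalar i ≤ G.intScalar i :=
  card_le_card (monotone_filter_right _ fun _ _ hj => isSome_of_restrict G keep hkeep hex _ hj)

/-- kernel: the new graph has at most as many internal A′-legs at each vertex. [cite: Balaban1983Higgs3, (2.1) p.422] -/
theorem intVector_restrict_le (i : Fin G.nV) : (restrict G keep hkeep hex).intVector i ≤ G.intVector i :=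
  card_le_card (monotone_filter_right _ fun _ _ hj => isSome_of_restrict G keep hkeep hex _ hj)

/-- kernel: the new graph has at most as many differentiations acting on internal lines at each vertex.
[cite: Balaban1983Higgs3, (2.1) p.422] -/
theorem intDiffs_restrict_le (i : Fin G.nV) : (restrict G keep hkeep hex).intDiffs i ≤ G.intDiffs i := by
  dsimp only [Graph.intDiffs, restrict]
  split_ifs <;> first | exact le_rfl | exact Nat.zero_le _ | simp_all

/-- (2.1) p. 422: at a vertex NOT of the form (1.14)–(1.15), replacing lines by external legs does not lower D_G(v), d ≥ 2 (legs
have dimension −(d−2)/2 ≤ 0, external fields 0, differentiations −1 only when acting on internal lines).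
[cite: Balaban1983Higgs3, (2.1) p.422] -/
theorem vertexDeg_le_restrict (d : ℕ) (hd : 2 ≤ d) (i : Fin G.nV) (hav : (G.kind i).isAveragingVertex = false) :
    G.vertexDeg d i ≤ (restrict G keep hkeep hex).vertexDeg d i := by
  have h1 : (((restrict G keep hkeep hex).intScalar i : ℕ) : ℚ) ≤ G.intScalar i :=
    by exact_mod_cast intScalar_restrict_le G keep hkeep hex i
  have h2 : (((restrict G keep hkeep hex).intVector i : ℕ) : ℚ) ≤ G.intVector i :=
    by exact_mod_cast intVector_restrict_le G keep hkeep hex i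
  have h3 : (((restrict G keep hkeep hex).intDiffs i : ℕ) : ℚ) ≤ G.intDiffs i :=
    by exact_mod_cast intDiffs_restrict_le G keep hkeep hex i
  have hd' : (2 : ℚ) ≤ d := by exact_mod_cast hd
  rw [G.vertexDeg_eq, (restrict G keep hkeep hex).vertexDeg_eq]
  change _ ≤ ((G.kind i).etaCount d : ℚ) + _ - _ + (if (G.kind i).isAveragingVertex then _ else 0)
  simp only [hav, Bool.false_eq_true, if_false, add_zero]
  push_cast
  nlinarith

/-- **p. 432** [PDF 22], verbatim: *"Generally, if we replace a line in an arbitrary graph G by a pair of external fields, then the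
degree of the new graph is greater or equal to the degree of G"* — PROVED for every graph of the model WITHOUT vertices of the form
(1.14)–(1.15), every dimension d ≥ 2, and any set of lines replaced (the vertices (1.14)–(1.15) are the printed exception of (2.1):
`deg_restrict_lt_of_averaging`). [cite: Balaban1983Higgs3, p.432] -/
theorem deg_le_deg_restrict (d : ℕ) (hd : 2 ≤ d) (hav : ∀ i, (G.kind i).isAveragingVertex = false) :
    G.deg d ≤ (restrict G keep hkeep hex).deg d := by
  rw [G.deg_eq, (restrict G keep hkeep hex).deg_eq]
  have := sum_le_sum fun i (_ : i ∈ (univ : Finset (Fin G.nV))) => vertexDeg_le_restrict G keep hkeep hex d hd i (hav i)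
  change (∑ i, G.vertexDeg d i) - (d : ℚ) ≤ (∑ i : Fin G.nV, (restrict G keep hkeep hex).vertexDeg d i) - d
  linarith

/-- **p. 432** [PDF 22], verbatim: *"thus a convergent graph is transformed into a convergent one"* — PROVED in d = 3 for EVERY graph
of the model and any set of lines replaced by external legs: a graph with a vertex of the form (1.13)–(1.15) keeps it and has
D > 0 before and after (Cor. 2.3, first clause: `B3Cor23ConcreteProof.deg_pos_of_hasVertex1315`); otherwise `deg_le_deg_restrict`.
[cite: Balaban1983Higgs3, p.432] -/
theorem deg_restrict_pos (hD : 0 < G.deg 3) : 0 < (restrict G keep hkeep hex).deg 3 := by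
  by_cases h1315 : G.HasVertex1315
  · obtain ⟨i, hi⟩ := h1315
    exact B3Cor23ConcreteProof.deg_pos_of_hasVertex1315 (restrict G keep hkeep hex) ⟨i, hi⟩
  · exact hD.trans_le (deg_le_deg_restrict G keep hkeep hex 3 (by norm_num) (isAveragingVertex_eq_false G h1315))

/-- d = 3: replacing lines by external legs cannot make a graph divergent; contrapositive form — if the new graph has D ≤ 0 then so
had G. [cite: Balaban1983Higgs3, p.432] -/
theorem deg_nonpos_of_restrict (hD : (restrict G keep hkeep hex).deg 3 ≤ 0) : G.deg 3 ≤ 0 := by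
  by_contra h
  push Not at h
  linarith [deg_restrict_pos G keep hkeep hex h]

end restrict

/-! ## One line replaced by a pair of external legs -/

/-- kernel: the legs other than the two endpoints of a line form a set closed under «the other endpoint».
[cite: Balaban1983Higgs3, p.415] -/
theorem keep_compl_line {a b : Leg G.kind} (hab : G.other a = some b) (x y : Leg G.kind) (hxy : G.other x = some y)
    (hx : x ≠ a ∧ x ≠ b) : y ≠ a ∧ y ≠ b := by
  constructor
  · rintro rfl
    have h := G.other_symm _ _ hxy
    rw [hab] at h
    exact hx.2 (Option.some.inj h).symm
  · rintro rfl
    have h1 := G.other_symm _ _ hab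
    have h2 := G.other_symm _ _ hxy
    rw [h1] at h2
    exact hx.1 (Option.some.inj h2).symm

/-- p. 432 [PDF 22]: *"if we replace a line in an arbitrary graph G by a pair of external fields"* — G with the line through the
internal leg `a` (other endpoint `b`) replaced by two external legs; another line must remain. [cite: Balaban1983Higgs3, p.432] -/
def cutLine (a b : Leg G.kind) (hab : G.other a = some b) (hrest : ∃ x, (x ≠ a ∧ x ≠ b) ∧ (G.other x).isSome) : Graph nbar :=
  restrict G (fun x => x ≠ a ∧ x ≠ b) (fun x y hxy hx => keep_compl_line G hab x y hxy hx) hrest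

/-- kernel: in the cut graph the two endpoints are external and every other leg is as in G. [cite: Balaban1983Higgs3, p.432] -/
theorem cutLine_other (a b : Leg G.kind) (hab : G.other a = some b) (hrest : ∃ x, (x ≠ a ∧ x ≠ b) ∧ (G.other x).isSome)
    (x : Leg G.kind) : (cutLine G a b hab hrest).other x = if x ≠ a ∧ x ≠ b then G.other x else none := rfl

/-- p. 432 for one line, graphs without vertices (1.14)–(1.15), d ≥ 2: D(G) ≤ D(G with the line replaced by two external legs).
[cite: Balaban1983Higgs3, p.432] -/
theorem deg_le_deg_cutLine (d : ℕ) (hd : 2 ≤ d) (hav : ∀ i, (G.kind i).isAveragingVertex = false) (a b : Leg G.kind)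
    (hab : G.other a = some b) (hrest : ∃ x, (x ≠ a ∧ x ≠ b) ∧ (G.other x).isSome) :
    G.deg d ≤ (cutLine G a b hab hrest).deg d :=
  deg_le_deg_restrict G _ _ hrest d hd hav

/-- p. 432 for one line, d = 3, every graph of the model: D(G) > 0 ⇒ D(cut graph) > 0. [cite: Balaban1983Higgs3, p.432] -/
theorem deg_cutLine_pos (a b : Leg G.kind) (hab : G.other a = some b) (hrest : ∃ x, (x ≠ a ∧ x ≠ b) ∧ (G.other x).isSome)
    (hD : 0 < G.deg 3) : 0 < (cutLine G a b hab hrest).deg 3 :=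
  deg_restrict_pos G _ _ hrest hD

/-! ## The printed exception: lines ending on A′-legs of vertices (1.14)–(1.15) -/

/-- Witness: two vertices of the form (1.14) with n = 1, n′ = 0 whose φ′-legs are joined by a scalar line and whose A′-legs
(A′(Γ^{(k)}_{y,x}), p. 413) are joined by a vector line (a graph of the model; cf. (1.18) *"a product of two factors of the form
(1.14) or (1.15)"* and p. 414 *"All the A′-legs are contracted"*). [cite: Balaban1983Higgs3, (1.14) p.413] -/
def avgPair (nbar : ℕ) (hn : 1 ≤ nbar) : Graph nbar where
  nV := 2
  kind _ := .v114 1 0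
  adm _ := by simp [VertexKind.Admissible, hn]
  other x := match x with
    | ⟨i, .inl j⟩ => some ⟨i.rev, .inl j⟩
    | ⟨i, .inr j⟩ => some ⟨i.rev, .inr j⟩
  other_ne := by decide
  other_symm := by decide
  other_isLeft := by decide
  exists_line := by decide

/-- The A′-leg of vertex 0 of `avgPair`, internal (joined to the A′-leg of vertex 1). [cite: Balaban1983Higgs3, (1.14) p.413] -/
theorem avgPair_vectorLine (hn : 1 ≤ nbar) :
    (avgPair nbar hn).other ⟨(0 : Fin 2), .inr ⟨0, Nat.one_pos⟩⟩ = some ⟨(1 : Fin 2), .inr ⟨0, Nat.one_pos⟩⟩ := rfl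

/-- kernel: after the vector line is replaced by external legs a line remains (the scalar line). [cite: Balaban1983Higgs3, p.432] -/
theorem avgPair_rest (hn : 1 ≤ nbar) :
    ∃ x : Leg (avgPair nbar hn).kind, (x ≠ ⟨(0 : Fin 2), .inr ⟨0, Nat.one_pos⟩⟩
      ∧ x ≠ ⟨(1 : Fin 2), .inr ⟨0, Nat.one_pos⟩⟩) ∧ ((avgPair nbar hn).other x).isSome :=
  ⟨⟨(0 : Fin 2), .inl ⟨0, Nat.one_pos⟩⟩, ⟨by simp, by simp⟩, rfl⟩

/-- kernel: D(`avgPair`) = 3 in d = 3 ((2.1): each vertex η³, internal φ′-leg −½, internal A′-leg −½ + 1: D_G(v) = 3).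
[cite: Balaban1983Higgs3, (2.1) p.422] -/
theorem avgPair_deg (hn : 1 ≤ nbar) : (avgPair nbar hn).deg 3 = 3 := by
  have a0 : (avgPair nbar hn).intScalar (0 : Fin 2) = 1 := by rfl
  have a1 : (avgPair nbar hn).intScalar (1 : Fin 2) = 1 := by rfl
  have b0 : (avgPair nbar hn).intVector (0 : Fin 2) = 1 := by rfl
  have b1 : (avgPair nbar hn).intVector (1 : Fin 2) = 1 := by rfl
  have c0 : (avgPair nbar hn).intDiffs (0 : Fin 2) = 0 := by rfl
  have c1 : (avgPair nbar hn).intDiffs (1 : Fin 2) = 0 := by rfl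
  rw [Graph.deg_eq]
  change (∑ i : Fin 2, (avgPair nbar hn).vertexDeg 3 i) - ((3 : ℕ) : ℚ) = 3
  rw [Fin.sum_univ_two, Graph.vertexDeg_eq, Graph.vertexDeg_eq, a0, a1, b0, b1, c0, c1]
  simp [avgPair, VertexKind.etaCount, VertexKind.isAveragingVertex]
  norm_num

/-- `avgPair` with its vector line replaced by a pair of external legs (p. 432). [cite: Balaban1983Higgs3, p.432] -/
def avgPairCut (nbar : ℕ) (hn : 1 ≤ nbar) : Graph nbar :=
  cutLine (avgPair nbar hn) _ _ (avgPair_vectorLine hn) (avgPair_rest hn)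

/-- kernel: with the vector line replaced by two external legs, D = 2 in d = 3 (each vertex loses the +½ of its internal averaged
A′-leg). [cite: Balaban1983Higgs3, (2.1) p.422] -/
theorem avgPairCut_deg (hn : 1 ≤ nbar) : (avgPairCut nbar hn).deg 3 = 2 := by
  have a0 : (avgPairCut nbar hn).intScalar (0 : Fin 2) = 1 := by rfl
  have a1 : (avgPairCut nbar hn).intScalar (1 : Fin 2) = 1 := by rfl
  have b0 : (avgPairCut nbar hn).intVector (0 : Fin 2) = 0 := by rfl
  have b1 : (avgPairCut nbar hn).intVector (1 : Fin 2) = 0 := by rfl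
  have c0 : (avgPairCut nbar hn).intDiffs (0 : Fin 2) = 0 := by rfl
  have c1 : (avgPairCut nbar hn).intDiffs (1 : Fin 2) = 0 := by rfl
  rw [Graph.deg_eq]
  change (∑ i : Fin 2, (avgPairCut nbar hn).vertexDeg 3 i) - ((3 : ℕ) : ℚ) = 2
  rw [Fin.sum_univ_two, Graph.vertexDeg_eq, Graph.vertexDeg_eq, a0, a1, b0, b1, c0, c1]
  simp [avgPairCut, cutLine, restrict, avgPair, VertexKind.etaCount, VertexKind.isAveragingVertex]
  norm_num

/-- **The printed inequality fails on the model for lines between A′-legs of two vertices (1.14)–(1.15)** (d = 3): for `avgPair`,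
replacing the vector line by a pair of external legs LOWERS the degree, 3 ↦ 2 — (2.1) counts such an internal leg with
−(d−2)/2 + 1 = +½ (the *"additional factor L^jη"* for each expression A′^{(j),η}(Γ^{(j+1)}), p. 426) and an external field with 0.
The printed consequence ("convergent ⇒ convergent") is unaffected: `deg_restrict_pos`. Recorded in HOME/GAPS.md; not adjudicated.
[cite: Balaban1983Higgs3, p.432] -/
theorem deg_restrict_lt_of_averaging (hn : 1 ≤ nbar) : (avgPairCut nbar hn).deg 3 < (avgPair nbar hn).deg 3 := by
  rw [avgPairCut_deg, avgPair_deg]; norm_num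

end Literature.MathematicalPhysics.QuantumFieldTheory.Balaban1983to89.B3LineCut
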